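import Summits.Ventures.PercRepro.RankLevelSetDepCountHeavyA
import Summits.Ventures.PercRepro.RankLevelSetDepCountGiantA2
import Summits.Ventures.PercRepro.RankLevelSetCountBounds

/-!
# PercRepro — THE HEAVY / LIGHT SPLIT OF THE `U`-COUNT, PART B: THE HEAVY SETS LIVE IN A SMALL UNION (p8, S3)

`proofs/SUBCLAIM-S3-p8.md` §3f. The rank-`(q−1)` flats of nullity `≥ ν₁` (`hFlats`, union `UH`) and the GOOD heavy
rank-`q` flats (`goodFlats`, union `UG`): by the union lemma of part A, `|UG| ≤ q + (j + 1)d − j·ν₁` and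
`|UH| ≤ (q − 1) + (j′ + 1)d − j′·ν₁` (`ncard_UG_le`, `ncard_UH_le`; `|UH| ≤ f′` when the `H`-flat is unique,
`ncard_UH_le_of_unique`; `UH = ∅` when no rank-`(q−1)` set is that big, `UH_eq_empty`). Every HEAVY rank-`q` set `B`
(`ν(cl B) ≥ ν₁`) lies in `UG` or in `insert x UH` for an `x ∈ E` (`heavy_subset`), so there are at most
`2^{|UG|} + (n + 1)·2^{|UH|}` of them (`ncard_heavy_le`). The LIGHT pairs (`pairsLight`: closure of nullity `≤ ν₁ − 1`)
have fibres over `≤ ν₁ − 2` free points (`card_fibreLevel_light`; `≤ min(f′ − q, ν₁ − 2)` for a small pair), and the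
level-`m` double count restricted to the light sets (`mul_card_levelLight_le_sum`). Axioms: standard.
-/

open scoped Matroid

namespace PercRepro

namespace Matroid

open Set Finset

variable {α : Type} {M : _root_.Matroid α}

/-- The rank-`(q−1)` flats of nullity `≥ ν₁`. -/
def IsHFlat (M : _root_.Matroid α) (q ν₁ : ℕ) (H : Set α) : Prop :=
  H ⊆ M.E ∧ M.closure H = H ∧ M.eRk H = ((q - 1 : ℕ) : ℕ∞) ∧ q - 1 + ν₁ ≤ H.ncard

/-- The GOOD heavy rank-`q` flats: nullity `≥ ν₁`, not of the form `insert x H` with `H` a rank-`(q−1)` flat of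
nullity `≥ ν₁`. -/
def IsGoodFlat (M : _root_.Matroid α) (q ν₁ : ℕ) (F : Set α) : Prop :=
  F ⊆ M.E ∧ M.closure F = F ∧ M.eRk F = (q : ℕ∞) ∧ q + ν₁ ≤ F.ncard ∧
    ∀ H, IsHFlat M q ν₁ H → ∀ x, F ≠ insert x H

/-- The rank-`(q−1)` flats of nullity `≥ ν₁`, as a finset. -/
noncomputable def hFlats (M : _root_.Matroid α) [M.Finite] (q ν₁ : ℕ) : Finset (Set α) :=
  (M.ground_finite.finite_subsets.subset (fun H (h : IsHFlat M q ν₁ H) => h.1)).toFinset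

/-- The good heavy rank-`q` flats, as a finset. -/
noncomputable def goodFlats (M : _root_.Matroid α) [M.Finite] (q ν₁ : ℕ) : Finset (Set α) :=
  (M.ground_finite.finite_subsets.subset (fun F (h : IsGoodFlat M q ν₁ F) => h.1)).toFinset

/-- The union of the rank-`(q−1)` flats of nullity `≥ ν₁`. -/
def UH (M : _root_.Matroid α) [M.Finite] (q ν₁ : ℕ) : Set α := ⋃ H ∈ hFlats M q ν₁, H

/-- The union of the good heavy rank-`q` flats. -/
def UG (M : _root_.Matroid α) [M.Finite] (q ν₁ : ℕ) : Set α := ⋃ F ∈ goodFlats M q ν₁, F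

/-- Membership in `hFlats`. -/
theorem mem_hFlats [M.Finite] {q ν₁ : ℕ} {H : Set α} : H ∈ hFlats M q ν₁ ↔ IsHFlat M q ν₁ H := by
  unfold hFlats
  rw [Set.Finite.mem_toFinset]
  rfl

/-- Membership in `goodFlats`. -/
theorem mem_goodFlats [M.Finite] {q ν₁ : ℕ} {F : Set α} : F ∈ goodFlats M q ν₁ ↔ IsGoodFlat M q ν₁ F := by
  unfold goodFlats
  rw [Set.Finite.mem_toFinset]
  rfl

/-- `UH ⊆ E`. -/
theorem UH_subset_ground [M.Finite] (q ν₁ : ℕ) : UH M q ν₁ ⊆ M.E := by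
  intro x hx
  unfold UH at hx
  rw [Set.mem_iUnion₂] at hx
  obtain ⟨H, hH, hxH⟩ := hx
  exact (mem_hFlats.1 hH).1 hxH

/-- `UG ⊆ E`. -/
theorem UG_subset_ground [M.Finite] (q ν₁ : ℕ) : UG M q ν₁ ⊆ M.E := by
  intro x hx
  unfold UG at hx
  rw [Set.mem_iUnion₂] at hx
  obtain ⟨F, hF, hxF⟩ := hx
  exact (mem_goodFlats.1 hF).1 hxF

/-- **`|UG| ≤ q + (j + 1)·d − j·ν₁`**: sets of rank `≤ q − 2` have nullity `≤ c < ν₁`, sets of rank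
`≤ q − j − 1` have nullity `≤ cj` with `d + cj + 1 ≤ 2ν₁`. -/
theorem ncard_UG_le [M.Finite] {q ν₁ j c cj d : ℕ} (hq : 2 ≤ q) (hd : M.E.encard = M.eRank + d)
    (hc : ∀ X ⊆ M.E, M.eRk X ≤ ((q - 2 : ℕ) : ℕ∞) → (X.ncard : ℕ∞) ≤ M.eRk X + c) (hν : c + 1 ≤ ν₁)
    (hcj : ∀ X ⊆ M.E, M.eRk X ≤ ((q - j - 1 : ℕ) : ℕ∞) → (X.ncard : ℕ∞) ≤ M.eRk X + cj)
    (hνj : d + cj + 1 ≤ 2 * ν₁) :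
    (UG M q ν₁).ncard ≤ q + (j + 1) * d - j * ν₁ := by
  unfold UG
  refine ncard_biUnion_le_of_heavy hd (goodFlats M q ν₁) (fun F hF => (mem_goodFlats.1 hF).1)
    (fun F hF => (mem_goodFlats.1 hF).2.2.1) (fun F hF => (mem_goodFlats.1 hF).2.2.2.1) ?_ ?_
  · intro F hF F' hF' _
    obtain ⟨hFE, -, hrF, hνF, -⟩ := mem_goodFlats.1 hF
    obtain ⟨hF'E, -, hrF', hνF', -⟩ := mem_goodFlats.1 hF'
    exact eRk_inter_ge_of_heavy hd hcj hνj hFE hF'E hrF hrF' hνF hνF'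
  · intro F hF S hS hSF r hr
    obtain ⟨hFE, hFc, hrF, hνF, hgood⟩ := mem_goodFlats.1 hF
    exact ncard_add_le_of_ssubset_good hq hc hν hFE hFc hrF hνF
      (fun H hHE hHc hrH hνH x => hgood H ⟨hHE, hHc, hrH, hνH⟩ x) hS hSF hr

/-- **`|UH| ≤ (q − 1) + (j′ + 1)·d − j′·ν₁`**. -/
theorem ncard_UH_le [M.Finite] {q ν₁ j' c cj' d : ℕ} (hq : 2 ≤ q) (hd : M.E.encard = M.eRank + d)
    (hc : ∀ X ⊆ M.E, M.eRk X ≤ ((q - 2 : ℕ) : ℕ∞) → (X.ncard : ℕ∞) ≤ M.eRk X + c) (hν : c + 1 ≤ ν₁)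
    (hcj' : ∀ X ⊆ M.E, M.eRk X ≤ ((q - 1 - j' - 1 : ℕ) : ℕ∞) → (X.ncard : ℕ∞) ≤ M.eRk X + cj')
    (hνj' : d + cj' + 1 ≤ 2 * ν₁) :
    (UH M q ν₁).ncard ≤ (q - 1) + (j' + 1) * d - j' * ν₁ := by
  unfold UH
  refine ncard_biUnion_le_of_heavy (ρ := q - 1) hd (hFlats M q ν₁) (fun H hH => (mem_hFlats.1 hH).1)
    (fun H hH => (mem_hFlats.1 hH).2.2.1) (fun H hH => (mem_hFlats.1 hH).2.2.2) ?_ ?_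
  · intro H hH H' hH' _
    obtain ⟨hHE, -, hrH, hνH⟩ := mem_hFlats.1 hH
    obtain ⟨hH'E, -, hrH', hνH'⟩ := mem_hFlats.1 hH'
    exact eRk_inter_ge_of_heavy hd hcj' hνj' hHE hH'E hrH hrH' hνH hνH'
  · intro H hH S hS hSH r hr
    obtain ⟨hHE, -, hrH, hνH⟩ := mem_hFlats.1 hH
    exact ncard_add_le_of_ssubset_hfam hq hc hν hHE hrH hνH hS hSH hr

/-- **The `H`-flat is unique when `d + c + 1 ≤ 2ν₁`** (two of them would meet in a set of rank `≤ q − 2` and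
nullity `≥ 2ν₁ − d > c`), so `|UH| ≤ f′` when rank-`≤ (q−1)` sets have `≤ f′` points. -/
theorem ncard_UH_le_of_unique [M.Finite] {q ν₁ c d f' : ℕ} (hd : M.E.encard = M.eRank + d)
    (hc : ∀ X ⊆ M.E, M.eRk X ≤ ((q - 2 : ℕ) : ℕ∞) → (X.ncard : ℕ∞) ≤ M.eRk X + c)
    (hνc : d + c + 1 ≤ 2 * ν₁)
    (hflat' : ∀ X ⊆ M.E, M.eRk X ≤ ((q - 1 : ℕ) : ℕ∞) → X.ncard ≤ f') :
    (UH M q ν₁).ncard ≤ f' := by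
  classical
  rcases (hFlats M q ν₁).eq_empty_or_nonempty with h | ⟨H₀, hH₀⟩
  · unfold UH
    rw [h]
    simp
  · obtain ⟨hH₀E, hH₀c, hrH₀, hνH₀⟩ := mem_hFlats.1 hH₀
    have hH₀fin : H₀.Finite := M.ground_finite.subset hH₀E
    have hsub : UH M q ν₁ ⊆ H₀ := by
      intro x hx
      unfold UH at hx
      rw [Set.mem_iUnion₂] at hx
      obtain ⟨H, hH, hxH⟩ := hx
      obtain ⟨hHE, hHc, hrH, hνH⟩ := mem_hFlats.1 hH
      have hc' : ∀ X ⊆ M.E, M.eRk X ≤ ((q - 1 - 0 - 1 : ℕ) : ℕ∞) → (X.ncard : ℕ∞) ≤ M.eRk X + c := by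
        intro X hX hr
        exact hc X hX (by rwa [show q - 1 - 0 - 1 = q - 2 by omega] at hr)
      have hi : ((q - 1 - 0 : ℕ) : ℕ∞) ≤ M.eRk (H ∩ H₀) :=
        eRk_inter_ge_of_heavy (ρ := q - 1) (j := 0) hd hc' hνc hHE hH₀E hrH hrH₀ hνH hνH₀
      rw [Nat.sub_zero] at hi
      have hHfin : H.Finite := M.ground_finite.subset hHE
      have hc₁ : M.closure (H ∩ H₀) = M.closure H :=
        (M.isRkFinite_of_finite (hHfin.subset inter_subset_left)).closure_eq_closure_of_subset_of_eRk_ge_eRk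
          inter_subset_left (by rw [hrH]; exact hi)
      have hc₂ : M.closure (H ∩ H₀) = M.closure H₀ :=
        (M.isRkFinite_of_finite (hH₀fin.subset inter_subset_right)).closure_eq_closure_of_subset_of_eRk_ge_eRk
          inter_subset_right (by rw [hrH₀]; exact hi)
      have hHH₀ : H = H₀ := by rw [← hHc, ← hH₀c, ← hc₁, hc₂]
      rw [← hHH₀]
      exact hxH
    exact (ncard_le_ncard hsub hH₀fin).trans (hflat' H₀ hH₀E (le_of_eq hrH₀))

/-- **`UH = ∅` when `f′ + 1 ≤ q − 1 + ν₁`** (no rank-`(q−1)` set has that many points). -/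
theorem UH_eq_empty [M.Finite] {q ν₁ f' : ℕ}
    (hflat' : ∀ X ⊆ M.E, M.eRk X ≤ ((q - 1 : ℕ) : ℕ∞) → X.ncard ≤ f') (h : f' + 1 ≤ q - 1 + ν₁) :
    UH M q ν₁ = ∅ := by
  rw [Set.eq_empty_iff_forall_notMem]
  intro x hx
  unfold UH at hx
  rw [Set.mem_iUnion₂] at hx
  obtain ⟨H, hH, -⟩ := hx
  obtain ⟨hHE, -, hrH, hνH⟩ := mem_hFlats.1 hH
  have := hflat' H hHE (le_of_eq hrH)
  omega

/-- **A heavy rank-`q` set lies in `UG` or in `insert x UH` for some `x ∈ E`.** -/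
theorem heavy_subset [M.Finite] {q ν₁ : ℕ} {B : Set α} (hB : B ⊆ M.E) (hrB : M.eRk B = (q : ℕ∞))
    (hheavy : q + ν₁ ≤ (M.closure B).ncard) :
    B ⊆ UG M q ν₁ ∨ ∃ x ∈ M.E, B ⊆ insert x (UH M q ν₁) := by
  have hFE : M.closure B ⊆ M.E := M.closure_subset_ground B
  have hBF : B ⊆ M.closure B := M.subset_closure B hB
  by_cases hg : ∀ H, IsHFlat M q ν₁ H → ∀ x, M.closure B ≠ insert x H
  · left
    have hFg : M.closure B ∈ goodFlats M q ν₁ :=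
      mem_goodFlats.2 ⟨hFE, M.closure_closure B, by rw [M.eRk_closure_eq]; exact hrB, hheavy, hg⟩
    intro y hy
    unfold UG
    rw [Set.mem_iUnion₂]
    exact ⟨M.closure B, hFg, hBF hy⟩
  · push Not at hg
    obtain ⟨H, hH, x, hFx⟩ := hg
    right
    have hxF : x ∈ M.closure B := by rw [hFx]; exact Set.mem_insert x H
    refine ⟨x, hFE hxF, ?_⟩
    intro y hy
    have hyF : y ∈ M.closure B := hBF hy
    rw [hFx] at hyF
    rcases hyF with h | h
    · rw [h]
      exact Set.mem_insert x _
    · apply Set.mem_insert_of_mem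
      unfold UH
      rw [Set.mem_iUnion₂]
      exact ⟨H, mem_hFlats.2 hH, h⟩

/-- **The number of heavy rank-`q` sets**: `≤ 2^{|UG|} + (n + 1)·2^{|UH|}`. -/
theorem ncard_heavy_le [M.Finite] (q ν₁ : ℕ) :
    {B : Set α | B ⊆ M.E ∧ M.eRk B = (q : ℕ∞) ∧ q + ν₁ ≤ (M.closure B).ncard}.ncard ≤
      2 ^ (UG M q ν₁).ncard + (M.E.ncard + 1) * 2 ^ (UH M q ν₁).ncard := by
  have hUGE := UG_subset_ground (M := M) q ν₁
  have hUHE := UH_subset_ground (M := M) q ν₁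
  have hUGfin : (UG M q ν₁).Finite := M.ground_finite.subset hUGE
  have hUHfin : (UH M q ν₁).Finite := M.ground_finite.subset hUHE
  set T₁ := 𝒫 (UG M q ν₁) with hT₁def
  set T₂ := {B : Set α | ∃ x ∈ M.E, B ⊆ insert x (UH M q ν₁)} with hT₂def
  have hsub : {B : Set α | B ⊆ M.E ∧ M.eRk B = (q : ℕ∞) ∧ q + ν₁ ≤ (M.closure B).ncard} ⊆ T₁ ∪ T₂ := by
    intro B hB
    rcases heavy_subset hB.1 hB.2.1 hB.2.2 with h | h
    · exact Or.inl h
    · exact Or.inr h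
  have hT₁fin : T₁.Finite := hUGfin.finite_subsets
  have hT₂fin : T₂.Finite := by
    apply M.ground_finite.finite_subsets.subset
    intro B hB
    obtain ⟨x, hxE, hBx⟩ := hB
    exact hBx.trans (Set.insert_subset hxE hUHE)
  have hT₁ : T₁.ncard = 2 ^ (UG M q ν₁).ncard := Set.ncard_powerset _ hUGfin
  have hT₂ : T₂.ncard ≤ (M.E.ncard + 1) * 2 ^ (UH M q ν₁).ncard := by
    have hfin : ({X : Set α | X ⊆ M.E ∧ X.ncard ≤ 1} ×ˢ 𝒫 (UH M q ν₁)).Finite :=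
      (M.ground_finite.finite_subsets.subset (fun X hX => hX.1)).prod hUHfin.finite_subsets
    have hinj : T₂.ncard ≤ ({X : Set α | X ⊆ M.E ∧ X.ncard ≤ 1} ×ˢ 𝒫 (UH M q ν₁)).ncard := by
      refine Set.ncard_le_ncard_of_injOn (fun B => (B \ UH M q ν₁, B ∩ UH M q ν₁)) ?_ ?_ hfin
      · intro B hB
        obtain ⟨x, hxE, hBx⟩ := hB
        rw [Set.mem_prod]
        refine ⟨⟨?_, ?_⟩, Set.inter_subset_right⟩
        · intro y hy
          exact (Set.insert_subset hxE hUHE) (hBx hy.1)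
        · have hsing : B \ UH M q ν₁ ⊆ {x} := by
            intro y hy
            rcases hBx hy.1 with h | h
            · exact h
            · exact absurd h hy.2
          exact (Set.ncard_le_ncard hsing (Set.finite_singleton x)).trans (by simp)
      · intro B _ B' _ h
        simp only [Prod.mk.injEq] at h
        rw [← Set.sdiff_union_inter B (UH M q ν₁), ← Set.sdiff_union_inter B' (UH M q ν₁), h.1, h.2]
    rw [Set.ncard_prod, Set.ncard_powerset _ hUHfin] at hinj
    have h1 : {X : Set α | X ⊆ M.E ∧ X.ncard ≤ 1}.ncard ≤ M.E.ncard + 1 := by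
      have := ncard_subsets_ncard_le (groundF M) 1
      rw [coe_groundF, card_groundF] at this
      simpa [Finset.sum_range_succ, add_comm] using this
    calc T₂.ncard ≤ _ := hinj
      _ ≤ (M.E.ncard + 1) * 2 ^ (UH M q ν₁).ncard := Nat.mul_le_mul_right _ h1
  calc _ ≤ (T₁ ∪ T₂).ncard := ncard_le_ncard hsub (hT₁fin.union hT₂fin)
    _ ≤ T₁.ncard + T₂.ncard := ncard_union_le _ _
    _ ≤ _ := by rw [hT₁]; exact Nat.add_le_add_left hT₂ _

open scoped Classical in
/-- The LIGHT pairs: closure of nullity `≤ ν₁ − 1`, i.e. with `≤ q + ν₁ − 1` points. -/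
noncomputable def pairsLight (M : _root_.Matroid α) [M.Finite] (q ν₁ : ℕ) : Finset (Set α × Set α) :=
  (pairsF M q).filter (fun p => (M.closure (p.1 ∪ p.2)).ncard + 1 ≤ q + ν₁)

open scoped Classical in
/-- The LIGHT rank-`q` sets of `m` elements: closure with `≤ q + ν₁ − 1` points. -/
noncomputable def levelLight (M : _root_.Matroid α) [M.Finite] (q ν₁ m : ℕ) : Finset (Finset α) :=
  (levelF M q m).filter (fun B => (M.closure (B : Set α)).ncard + 1 ≤ q + ν₁)

open scoped Classical in
/-- The HEAVY rank-`q` sets of `m` elements: closure with `≥ q + ν₁` points. -/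
noncomputable def levelHeavy (M : _root_.Matroid α) [M.Finite] (q ν₁ m : ℕ) : Finset (Finset α) :=
  (levelF M q m).filter (fun B => q + ν₁ ≤ (M.closure (B : Set α)).ncard)

open scoped Classical in
/-- `#levelF = #levelLight + #levelHeavy`. -/
theorem card_levelF_eq_light_add_heavy [M.Finite] (q ν₁ m : ℕ) :
    (levelF M q m).card = (levelLight M q ν₁ m).card + (levelHeavy M q ν₁ m).card := by
  unfold levelLight levelHeavy
  have hfilt : (levelF M q m).filter (fun B : Finset α => ¬ ((M.closure (B : Set α)).ncard + 1 ≤ q + ν₁)) =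
      (levelF M q m).filter (fun B : Finset α => q + ν₁ ≤ (M.closure (B : Set α)).ncard) := by
    apply Finset.filter_congr
    intro B _
    omega
  rw [← hfilt]
  exact (Finset.card_filter_add_card_filter_not (s := levelF M q m)
    (fun B : Finset α => (M.closure (B : Set α)).ncard + 1 ≤ q + ν₁)).symm

/-- A pair reaching `B` (`C ∪ B′ ⊆ B ⊆ cl(C ∪ B′)`) has the closure of `B`. -/
theorem closure_eq_of_reaches {p : Set α × Set α} {B : Set α}
    (h1 : p.1 ∪ p.2 ⊆ B) (h2 : B ⊆ M.closure (p.1 ∪ p.2)) : M.closure (p.1 ∪ p.2) = M.closure B :=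
  Set.Subset.antisymm (M.closure_subset_closure h1)
    (by rw [← M.closure_closure (p.1 ∪ p.2)]; exact M.closure_subset_closure h2)

open scoped Classical in
/-- **The level-`m` double count of the LIGHT sets**: `(m − q)·#levelLight ≤ Σ_{p ∈ pairsLight} #fibreLevel p m`
(every pair reaching a light set is light). -/
theorem mul_card_levelLight_le_sum [M.Finite] (q ν₁ : ℕ) (hcirc : ∀ C, M.IsCircuit C → 3 ≤ C.encard) (m : ℕ) :
    (m - q) * (levelLight M q ν₁ m).card ≤ ∑ p ∈ pairsLight M q ν₁, (fibreLevel M q p m).card := by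
  have hstep1 : ∀ p : Set α × Set α, ((levelLight M q ν₁ m).filter (fun B : Finset α =>
      p.1 ∪ p.2 ⊆ (B : Set α) ∧ (B : Set α) ⊆ M.closure (p.1 ∪ p.2))).card ≤ (fibreLevel M q p m).card := by
    intro p
    unfold fibreLevel levelLight
    exact Finset.card_le_card (Finset.filter_subset_filter
      (fun B : Finset α => p.1 ∪ p.2 ⊆ (B : Set α) ∧ (B : Set α) ⊆ M.closure (p.1 ∪ p.2))
      (Finset.filter_subset (fun B : Finset α => (M.closure (B : Set α)).ncard + 1 ≤ q + ν₁) (levelF M q m)))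
  have hcomm : ∑ p ∈ pairsLight M q ν₁, ((levelLight M q ν₁ m).filter (fun B : Finset α =>
      p.1 ∪ p.2 ⊆ (B : Set α) ∧ (B : Set α) ⊆ M.closure (p.1 ∪ p.2))).card =
      ∑ B ∈ levelLight M q ν₁ m, ((pairsLight M q ν₁).filter (fun p : Set α × Set α =>
        p.1 ∪ p.2 ⊆ (B : Set α) ∧ (B : Set α) ⊆ M.closure (p.1 ∪ p.2))).card := by
    have e1 : ∀ p : Set α × Set α, ((levelLight M q ν₁ m).filter (fun B : Finset α =>
        p.1 ∪ p.2 ⊆ (B : Set α) ∧ (B : Set α) ⊆ M.closure (p.1 ∪ p.2))).card =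
        ∑ B ∈ levelLight M q ν₁ m,
          if p.1 ∪ p.2 ⊆ (B : Set α) ∧ (B : Set α) ⊆ M.closure (p.1 ∪ p.2) then 1 else 0 :=
      fun p => Finset.card_filter _ _
    have e2 : ∀ B : Finset α, ((pairsLight M q ν₁).filter (fun p : Set α × Set α =>
        p.1 ∪ p.2 ⊆ (B : Set α) ∧ (B : Set α) ⊆ M.closure (p.1 ∪ p.2))).card =
        ∑ p ∈ pairsLight M q ν₁,
          if p.1 ∪ p.2 ⊆ (B : Set α) ∧ (B : Set α) ⊆ M.closure (p.1 ∪ p.2) then 1 else 0 :=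
      fun B => Finset.card_filter _ _
    rw [Finset.sum_congr rfl (fun p _ => e1 p), Finset.sum_congr rfl (fun B _ => e2 B)]
    exact Finset.sum_comm
  have hB : ∀ B ∈ levelLight M q ν₁ m, m - q ≤ ((pairsLight M q ν₁).filter (fun p : Set α × Set α =>
      p.1 ∪ p.2 ⊆ (B : Set α) ∧ (B : Set α) ⊆ M.closure (p.1 ∪ p.2))).card := by
    intro B hB
    unfold levelLight at hB
    rw [Finset.mem_filter] at hB
    obtain ⟨hBl, hlight⟩ := hB
    obtain ⟨hBg, hBm, hBq⟩ := mem_levelF.1 hBl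
    have hBE : (B : Set α) ⊆ M.E := by rw [← coe_groundF]; exact_mod_cast hBg
    have h := card_pairs_ge q hcirc hBE hBq
    rw [hBm] at h
    refine h.trans (Finset.card_le_card ?_)
    intro p hp
    rw [Finset.mem_filter] at hp ⊢
    refine ⟨?_, hp.2⟩
    unfold pairsLight
    rw [Finset.mem_filter]
    refine ⟨hp.1, ?_⟩
    rw [closure_eq_of_reaches hp.2.1 hp.2.2]
    exact hlight
  calc (m - q) * (levelLight M q ν₁ m).card = ∑ _B ∈ levelLight M q ν₁ m, (m - q) := by simp [mul_comm]
    _ ≤ ∑ B ∈ levelLight M q ν₁ m, ((pairsLight M q ν₁).filter (fun p : Set α × Set α =>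
        p.1 ∪ p.2 ⊆ (B : Set α) ∧ (B : Set α) ⊆ M.closure (p.1 ∪ p.2))).card := Finset.sum_le_sum hB
    _ = _ := hcomm.symm
    _ ≤ ∑ p ∈ pairsLight M q ν₁, (fibreLevel M q p m).card := Finset.sum_le_sum (fun p _ => hstep1 p)

open scoped Classical in
/-- The fibre of a LIGHT pair at level `m`: `≤ C(ν₁ − 2, m − q − 1)`. -/
theorem card_fibreLevel_light [M.Finite] (q ν₁ : ℕ) {p : Set α × Set α} (hp : p ∈ pairsLight M q ν₁) (m : ℕ) :
    (fibreLevel M q p m).card ≤ (ν₁ - 2).choose (m - (q + 1)) := by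
  unfold pairsLight at hp
  rw [Finset.mem_filter] at hp
  obtain ⟨hpP, hlight⟩ := hp
  obtain ⟨hp1E, hp2E, hU, -, -⟩ := pairsF_data hpP
  have hUE : p.1 ∪ p.2 ⊆ M.E := union_subset hp1E hp2E
  have hFfin : (M.closure (p.1 ∪ p.2)).Finite := M.ground_finite.subset (M.closure_subset_ground _)
  have hUF : p.1 ∪ p.2 ⊆ M.closure (p.1 ∪ p.2) := M.subset_closure _ hUE
  have hFU : (M.closure (p.1 ∪ p.2) \ (p.1 ∪ p.2)).ncard ≤ ν₁ - 2 := by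
    rw [ncard_sdiff hUF (hFfin.subset hUF), hU]
    omega
  exact (card_fibreLevel_le_choose q hpP m).trans (Nat.choose_le_choose _ hFU)

open scoped Classical in
/-- The fibre of a LIGHT SMALL pair at level `m`: `≤ C(min (f′ − q) (ν₁ − 2), m − q − 1)`. -/
theorem card_fibreLevel_light_small [M.Finite] (q f' ν₁ : ℕ) {p : Set α × Set α} (hp : p ∈ pairsLight M q ν₁)
    (hps : p ∈ pairsSmall M q f') (m : ℕ) :
    (fibreLevel M q p m).card ≤ (min (f' - q) (ν₁ - 2)).choose (m - (q + 1)) := by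
  unfold pairsLight at hp
  rw [Finset.mem_filter] at hp
  obtain ⟨hpP, hlight⟩ := hp
  unfold pairsSmall at hps
  rw [Finset.mem_filter] at hps
  obtain ⟨hp1E, hp2E, hU, -, -⟩ := pairsF_data hpP
  have hUE : p.1 ∪ p.2 ⊆ M.E := union_subset hp1E hp2E
  have hFfin : (M.closure (p.1 ∪ p.2)).Finite := M.ground_finite.subset (M.closure_subset_ground _)
  have hUF : p.1 ∪ p.2 ⊆ M.closure (p.1 ∪ p.2) := M.subset_closure _ hUE
  have hFU : (M.closure (p.1 ∪ p.2) \ (p.1 ∪ p.2)).ncard ≤ min (f' - q) (ν₁ - 2) := by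
    rw [ncard_sdiff hUF (hFfin.subset hUF), hU]
    have := hps.2
    omega
  exact (card_fibreLevel_le_choose q hpP m).trans (Nat.choose_le_choose _ hFU)

end Matroid

end PercRepro
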